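import Summits.BirchSwinnertonDyer.BirchSwinnertonDyer.Theorems.TameQuarticManinParityTprimeHeegnerUpperOfManinUnitIrreducibleRows
import Summits.BirchSwinnertonDyer.BirchSwinnertonDyer.Theorems.RamifiedHeegnerPairLeafRankOneUpperAtThreeTwistUnit
import Summits.BirchSwinnertonDyer.BirchSwinnertonDyer.Theses.TameQuarticSolvent
import Summits.BirchSwinnertonDyer.BirchSwinnertonDyer.Theses.TameQuarticManinParity
import HarnessLib

/-!
# Crux X₄ `TprimeHeegnerUpperOfManinUnit` (stmt-BirchSwinnertonDyer-23738), line `rows_of_manin_unit` (05f83a59) —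
# (A) the crux BY NAME from the p-stub, ONE Σ-input on the irreducible optimal rows, KT's rank-zero lower half 19981 and the
# reducible stub r₃ (r₁ and r₂ MERGED in the kernel); (B) the irreducible rows over a TWIST-UNIT field: L₀-free, and on the
# Tamagawa-free rows from PRINT + the twist-unit datum alone

HONEST FRAMING. Theorems only; helper file (`--supports stmt-BirchSwinnertonDyer-23738 --as helper`, leafhand
`leafhand-bsd-tamequarticmaninpa-3` g0, 2026-08-31); no definition, no named fact, no `sorry`; CONDITIONAL on every displayed
input; no stub is closed by name, no item is closed, BSD is proved for no curve. Companion of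
`TameQuarticManinParityTprimeHeegnerUpperOfManinUnitIrreducibleRows.lean` (same seat), whose §3 showed that the two
irreducible-image research stubs r₁ (`stub_ontoRowsOfManinUnit`) and r₂ (`stub_smallImageIrreducibleRowsOfManinUnit`) of the
registered skeleton follow from ONE displayed input Σ (global `3^{s′}`-divisibility of the derived Heegner points to depth
`ord₃ ∏_ℓ c_ℓ(E)`, the Manin unit spent) + the (t′) rank-ZERO lower half + print.

* §1 `tprimeHeegnerUpperOfManinUnit_of_reduce_of_sigma_of_tameLowerHalfRankZero_of_reducibleRows` — route
  `TameQuarticManinParity`'s crux decl `TprimeHeegnerUpperOfManinUnit` BY NAME (and `…_tqs` its `TameQuarticSolvent` twin,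
  the registered skeleton's `crux_decl`) from: PUB (Gross–Zagier ∀, Kolyvagin ∀, GZK, GZ I.(7.3), Matar–Nekovář 2019 Thm 0.7,
  newform existence, Friedberg–Hoffstein split-divisors), the p-stub `stub_reduceToOptimalDatum` (signature VERBATIM, its
  antecedent `UpperOnOptimalData` spelled out), Σ on the irreducible optimal (t′) rank-one rows with `3 ∤ c(D)`, route KT's item
  `TameLowerHalfRankZero` (19981) BY NAME, and the reducible stub r₃ `stub_reducibleRowsOfManinUnit` (signature VERBATIM). The
  kernel composition is the skeleton's `TprimeHeegnerUpperOfManinUnit_of` with the case split «onto?» REMOVED: the crux's own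
  antecedents 23736 / 23737 produce the Manin unit on the optimal datum, which sets the Σ-depth to `ord₃ ∏_ℓ c_ℓ`.
* §2 `upper_three_of_irreducible_of_sigmaAtDatum_of_twistUnit` — GENERIC additive `3`, `E[3]` irreducible, non-CM, `r_an = 1`:
  Σ at ONE datum over the SPLIT TWIST-UNIT field `SchneiderFree.Upper.TwistUnitFieldAt W 3` (a Heegner field `K` of `W` with
  `L(W^{(d_K)},1) ≠ 0` and a unit member `#Ш_an(W₂^{(d_K)}) ∈ ℤ₃^×` in the isogeny class — per class a finite exact certificate)
  gives the upper half with NO rank-zero lower half (Cassels' invariance transports the unit; RHP's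
  `missingLowerBoundAt_twistModel_of_unitMember`); `…_tamFree_of_print_of_twistUnit`: on the Tamagawa-free rows with `3 ∤ c`
  the upper half follows from PRINT + the twist-unit datum ALONE (generic additive `3`; covers both irreducible-image stubs' rows).
* §3 `tprimeHeegnerUpperOfManinUnit_of_reduce_of_sigma_of_twistUnitSupply_of_reducibleRows` — the crux BY NAME with KT 19981
  replaced by a CLASS-WIDE split twist-unit supply on the irreducible (t′) rank-one rows (a Vatsal / Kriz–Li-type statement).

References: [cite: MatarNekovar2019, Thm. 0.7 (p. 456) and §0.11 (p. 457)] [cite: Jetchev2008, Conj. 1.3, Thm. 1.4 (p. 812)]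
[cite: FriedbergHoffstein1995, Thm. B] [cite: GrossZagier1986, Thm. I.(6.3) and (7.3)] [cite: MilneADT2006, Thm. I.7.3]
[cite: Miller2011LMS, §1 and Def. 1.1] [cite: Cassels1965ArithmeticVIII, Thm. 1.3].
-/

-- D-0017: single-problem summit, so `Summit.BirchSwinnertonDyer.BirchSwinnertonDyer.…` repeats a namespace BY DESIGN.
set_option linter.dupNamespace false
set_option autoImplicit false

noncomputable section

open scoped Classical NumberField
open WeierstrassCurve IsDedekindDomain NumberField Literature Literature.NumberTheory.EllipticCurves
  Literature.NumberTheory.EllipticCurves.ModularForms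
  Literature.NumberTheory.EllipticCurves.Rank1Residual
  Literature.NumberTheory.EllipticCurves.Rank1Residual.Typed
  Literature.NumberTheory.EllipticCurves.KrizLi2019
  Literature.NumberTheory.QuadraticFields
  Summit.BirchSwinnertonDyer.Rank1Residual
  Summit.BirchSwinnertonDyer.Rank1Residual.Additive
  Summit.BirchSwinnertonDyer.Rank1Residual.X11b
  Summit.BirchSwinnertonDyer.Rank1Residual.X11b.Three
  Summit.BirchSwinnertonDyer.BirchSwinnertonDyer.Theses
  Summit.BirchSwinnertonDyer.BirchSwinnertonDyer.Theorems
  Summit.BirchSwinnertonDyer.BirchSwinnertonDyer.Theorems.SchneiderFree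
  Summit.BirchSwinnertonDyer.BirchSwinnertonDyer.Theorems.RamifiedPairUpperBound

namespace Summit.BirchSwinnertonDyer.BirchSwinnertonDyer.Theorems.TprimeHeegnerUpperOfManinUnit

/-! ## §1 The crux BY NAME with r₁ and r₂ merged into one Σ-input -/

/-- **Core composition (route-agnostic Manin-unit suppliers).** For ANY two suppliers `hMi` / `hMr` of the Manin `3`-unit on the
lattice-optimal, degree-minimal data of the non-CM (t′) rows with `E[3]` irreducible resp. reducible (the common unfolded type of
both routes' `TprimeIrreducibleManinUnit` / `TprimeReducibleManinUnit`): PUB + the p-stub `hRed` (signature VERBATIM) + Σ on the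
irreducible optimal (t′) rank-one rows with `3 ∤ c(D)` + the non-CM (t′) rank-ZERO lower half `hL0` + the reducible stub `hR3`
(signature VERBATIM) give the ∀-body of the crux. Kernel = the skeleton's composition with the «onto?» split removed
(companion file §3 for the irreducible rows). CONDITIONAL; closes nothing. [cite: MatarNekovar2019, Thm. 0.7 (p. 456)]
[cite: Jetchev2008, Conj. 1.3 (p. 812)] [cite: FriedbergHoffstein1995, Thm. B] [cite: Miller2011LMS, Def. 1.1] -/
theorem tprime_upper_three_rankOne_of_maninUnits_of_reduce_of_sigma_of_lowerRankZero_of_reducibleRows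
    (hGZ : ∀ (N : ℕ) [NeZero N] (W : WeierstrassCurve ℚ) (K : Type) [Field K] [NumberField K],
      gross_zagier N W K)
    (hKo : ∀ (N : ℕ) [NeZero N] (W : WeierstrassCurve ℚ) (K : Type) [Field K] [NumberField K],
      kolyvagin N W K)
    (hGZK : rank_eq_analyticRank_of_analyticRank_le_one) (hGZ73 : GrossZagier1986_thm_I_7_3)
    (hMN : MatarNekovar2019.thm07_padicValNat_card_sha_primary_add_le_of_globalDivisibility_of_irreducible)
    (hnf : exists_isNewformOf) (hFH : friedbergHoffstein_exists_heegnerField_splitDivisors_twist_ne_zero)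
    (hMi : ∀ (W : WeierstrassCurve ℚ) [W.IsElliptic] [W.IsGloballyMinimal] [NeZero (W.conductorNorm ℤ)],
      ¬ W.HasCM → Addv W 3 → SubTprime W 3 → W.HasIrreducibleModPGaloisRep 3 →
      ∀ (D : ModularParametrizationData W (W.conductorNorm ℤ)),
        (∀ z ∈ D.L.lattice, ∃ w ∈ periodLattice D.f, z = D.c * w) →
        (∀ (W' : WeierstrassCurve ℚ) [W'.IsElliptic] (D' : ModularParametrizationData W' (W.conductorNorm ℤ)),
          D'.f = D.f → D.modularDegree ≤ D'.modularDegree) →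
        ¬ (3 : ℤ) ∣ D.maninConstant)
    (hMr : ∀ (W : WeierstrassCurve ℚ) [W.IsElliptic] [W.IsGloballyMinimal] [NeZero (W.conductorNorm ℤ)],
      ¬ W.HasCM → Addv W 3 → SubTprime W 3 → ¬ W.HasIrreducibleModPGaloisRep 3 →
      ∀ (D : ModularParametrizationData W (W.conductorNorm ℤ)),
        (∀ z ∈ D.L.lattice, ∃ w ∈ periodLattice D.f, z = D.c * w) →
        (∀ (W' : WeierstrassCurve ℚ) [W'.IsElliptic] (D' : ModularParametrizationData W' (W.conductorNorm ℤ)),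
          D'.f = D.f → D.modularDegree ≤ D'.modularDegree) →
        ¬ (3 : ℤ) ∣ D.maninConstant)
    (hRed : (∀ (W : WeierstrassCurve ℚ) [W.IsElliptic] [W.IsGloballyMinimal] [NeZero (W.conductorNorm ℤ)],
        ¬ W.HasCM → Rank1Residual.Addv W 3 → Summit.BirchSwinnertonDyer.Rank1Residual.Additive.SubTprime W 3 →
        W.analyticRank = 1 →
        ∀ (D : ModularParametrizationData W (W.conductorNorm ℤ)),
          (∀ z ∈ D.L.lattice, ∃ w ∈ periodLattice D.f, z = D.c * w) →
          (∀ (W' : WeierstrassCurve ℚ) [W'.IsElliptic] (D' : ModularParametrizationData W' (W.conductorNorm ℤ)),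
              D'.f = D.f → D.modularDegree ≤ D'.modularDegree) →
          Rank1Residual.Typed.MissingUpperBoundAt W 3) →
      ∀ (W : WeierstrassCurve ℚ) [W.IsElliptic] [W.IsGloballyMinimal],
        ¬ W.HasCM → Rank1Residual.Addv W 3 → Summit.BirchSwinnertonDyer.Rank1Residual.Additive.SubTprime W 3 →
        W.analyticRank = 1 → Rank1Residual.Typed.MissingUpperBoundAt W 3)
    (hSig : ∀ (W : WeierstrassCurve ℚ) [W.IsElliptic] [W.IsGloballyMinimal] [NeZero (W.conductorNorm ℤ)]
      (K : Type) [Field K] [NumberField K] (Dt : ModularParametrizationData W (W.conductorNorm ℤ))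
      (H : HeegnerDatum (W.conductorNorm ℤ) (NumberField.discr K)) (ι : K →+* ℂ) (P : (W.baseChange K).toAffine.Point),
      ¬ W.HasCM → Addv W 3 → SubTprime W 3 → W.HasIrreducibleModPGaloisRep 3 → W.analyticRank = 1 →
      ¬ (3 : ℤ) ∣ Dt.c → IsImaginaryQuadratic K → SatisfiesHeegnerHypothesis (W.conductorNorm ℤ) K →
      (W.quadraticTwist (NumberField.discr K : ℚ)).entireLFunction 1 ≠ 0 →
      WeierstrassCurve.Affine.Point.map ι.toRatAlgHom P = heegnerPointComplex Dt H → ¬ IsOfFinAddOrder P →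
      Odd (NumberField.discr K) →
      ∀ (s' : ℕ), s' ≤ padicValNat 3 W.tamagawaProduct →
      ∀ (n : ℕ) (d : KolyvaginHeegnerData Dt H.β ι n), Squarefree n →
      (∀ ℓ ∈ n.primeFactors, Zhang2014.IsKolyvaginPrime (W.conductorNorm ℤ) W K 3 ℓ ∧
        s' ≤ Zhang2014.kolyvaginIndex W 3 ℓ) → Koly.PDiv d 3 s')
    (hL0 : ∀ (V : WeierstrassCurve ℚ) [V.IsElliptic] [V.IsGloballyMinimal],
      ¬ V.HasCM → Addv V 3 → SubTprime V 3 → V.analyticRank = 0 → MissingLowerBoundAt V 3)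
    (hR3 : ∀ (W : WeierstrassCurve ℚ) [W.IsElliptic] [W.IsGloballyMinimal] [NeZero (W.conductorNorm ℤ)],
      ¬ W.HasCM → Rank1Residual.Addv W 3 → Summit.BirchSwinnertonDyer.Rank1Residual.Additive.SubTprime W 3 →
      ¬ W.HasIrreducibleModPGaloisRep 3 → W.analyticRank = 1 →
      ∀ (D : ModularParametrizationData W (W.conductorNorm ℤ)), ¬ (3 : ℤ) ∣ D.maninConstant →
        Rank1Residual.Typed.MissingUpperBoundAt W 3) :
    ∀ (W : WeierstrassCurve ℚ) [W.IsElliptic] [W.IsGloballyMinimal],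
      ¬ W.HasCM → Rank1Residual.Addv W 3 → Summit.BirchSwinnertonDyer.Rank1Residual.Additive.SubTprime W 3 →
      W.analyticRank = 1 → Rank1Residual.Typed.MissingUpperBoundAt W 3 := by
  have hmod : hasEntireLFunction_rat := hasEntireLFunction_rat_of_exists_isNewformOf hnf
  intro W _ _ hCM hadd hsub hr
  refine hRed ?_ W hCM hadd hsub hr
  intro W₀ _ _ _ hCM₀ hadd₀ hsub₀ hr₀ D₀ hlat hmin
  by_cases hirr : W₀.HasIrreducibleModPGaloisRep 3
  · -- irreducible optimal rows (onto OR normaliser image): the Manin unit of 23736 sets the Σ-depth to `ord₃ ∏ c_ℓ`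
    have hc : ¬ (3 : ℤ) ∣ D₀.c := hMi W₀ hCM₀ hadd₀ hsub₀ hirr D₀ hlat hmin
    refine tprime_upper_three_of_irreducible_of_sigmaAtDatum_of_lowerRankZero hGZ hKo hGZK hmod hGZ73 hMN hnf hFH hL0
      W₀ hCM₀ hadd₀ hsub₀ hirr hr₀ D₀ ?_
    have hc0 : padicValNat 3 D₀.c.natAbs = 0 :=
      padicValNat.eq_zero_of_not_dvd fun h ↦ hc (Int.ofNat_dvd_left.mpr h)
    intro K _ _ H ι P hK hHN hLt hP hnt hodd s' hs' n d hn hℓ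
    exact hSig W₀ K D₀ H ι P hCM₀ hadd₀ hsub₀ hirr hr₀ hc hK hHN hLt hP hnt hodd s' (by omega) n d hn hℓ
  · -- reducible optimal rows: the Manin unit of 23737 feeds the reducible stub r₃
    exact hR3 W₀ hCM₀ hadd₀ hsub₀ hirr hr₀ D₀ (hMr W₀ hCM₀ hadd₀ hsub₀ hirr D₀ hlat hmin)

/-- **Route `TameQuarticManinParity`'s crux `TprimeHeegnerUpperOfManinUnit` (stmt-BirchSwinnertonDyer-23738) BY NAME** from
PUB, the p-stub `stub_reduceToOptimalDatum` (VERBATIM), ONE Σ-input on the irreducible optimal (t′) rank-one rows with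
`3 ∤ c(D)` (depth `ord₃ ∏_ℓ c_ℓ`), route KT's item `TameLowerHalfRankZero` (stmt-BirchSwinnertonDyer-19981) BY NAME, and the
reducible stub r₃ `stub_reducibleRowsOfManinUnit` (VERBATIM): the crux's own antecedents (its route's 23736 / 23737) supply the
Manin unit. Compared with the registered 4-stub skeleton, r₁ and r₂ are replaced by the single displayed Σ. CONDITIONAL;
credits nothing; the item stays open. [cite: MatarNekovar2019, Thm. 0.7 (p. 456) and §0.11 (p. 457)]
[cite: Jetchev2008, Conj. 1.3 (p. 812)] [cite: FriedbergHoffstein1995, Thm. B] [cite: Miller2011LMS, Def. 1.1] -/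
theorem tprimeHeegnerUpperOfManinUnit_of_reduce_of_sigma_of_tameLowerHalfRankZero_of_reducibleRows
    (hGZ : ∀ (N : ℕ) [NeZero N] (W : WeierstrassCurve ℚ) (K : Type) [Field K] [NumberField K],
      gross_zagier N W K)
    (hKo : ∀ (N : ℕ) [NeZero N] (W : WeierstrassCurve ℚ) (K : Type) [Field K] [NumberField K],
      kolyvagin N W K)
    (hGZK : rank_eq_analyticRank_of_analyticRank_le_one) (hGZ73 : GrossZagier1986_thm_I_7_3)
    (hMN : MatarNekovar2019.thm07_padicValNat_card_sha_primary_add_le_of_globalDivisibility_of_irreducible)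
    (hnf : exists_isNewformOf) (hFH : friedbergHoffstein_exists_heegnerField_splitDivisors_twist_ne_zero)
    (hRed : (∀ (W : WeierstrassCurve ℚ) [W.IsElliptic] [W.IsGloballyMinimal] [NeZero (W.conductorNorm ℤ)],
        ¬ W.HasCM → Rank1Residual.Addv W 3 → Summit.BirchSwinnertonDyer.Rank1Residual.Additive.SubTprime W 3 →
        W.analyticRank = 1 →
        ∀ (D : ModularParametrizationData W (W.conductorNorm ℤ)),
          (∀ z ∈ D.L.lattice, ∃ w ∈ periodLattice D.f, z = D.c * w) →
          (∀ (W' : WeierstrassCurve ℚ) [W'.IsElliptic] (D' : ModularParametrizationData W' (W.conductorNorm ℤ)),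
              D'.f = D.f → D.modularDegree ≤ D'.modularDegree) →
          Rank1Residual.Typed.MissingUpperBoundAt W 3) →
      ∀ (W : WeierstrassCurve ℚ) [W.IsElliptic] [W.IsGloballyMinimal],
        ¬ W.HasCM → Rank1Residual.Addv W 3 → Summit.BirchSwinnertonDyer.Rank1Residual.Additive.SubTprime W 3 →
        W.analyticRank = 1 → Rank1Residual.Typed.MissingUpperBoundAt W 3)
    (hSig : ∀ (W : WeierstrassCurve ℚ) [W.IsElliptic] [W.IsGloballyMinimal] [NeZero (W.conductorNorm ℤ)]
      (K : Type) [Field K] [NumberField K] (Dt : ModularParametrizationData W (W.conductorNorm ℤ))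
      (H : HeegnerDatum (W.conductorNorm ℤ) (NumberField.discr K)) (ι : K →+* ℂ) (P : (W.baseChange K).toAffine.Point),
      ¬ W.HasCM → Addv W 3 → SubTprime W 3 → W.HasIrreducibleModPGaloisRep 3 → W.analyticRank = 1 →
      ¬ (3 : ℤ) ∣ Dt.c → IsImaginaryQuadratic K → SatisfiesHeegnerHypothesis (W.conductorNorm ℤ) K →
      (W.quadraticTwist (NumberField.discr K : ℚ)).entireLFunction 1 ≠ 0 →
      WeierstrassCurve.Affine.Point.map ι.toRatAlgHom P = heegnerPointComplex Dt H → ¬ IsOfFinAddOrder P →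
      Odd (NumberField.discr K) →
      ∀ (s' : ℕ), s' ≤ padicValNat 3 W.tamagawaProduct →
      ∀ (n : ℕ) (d : KolyvaginHeegnerData Dt H.β ι n), Squarefree n →
      (∀ ℓ ∈ n.primeFactors, Zhang2014.IsKolyvaginPrime (W.conductorNorm ℤ) W K 3 ℓ ∧
        s' ≤ Zhang2014.kolyvaginIndex W 3 ℓ) → Koly.PDiv d 3 s')
    (hKT : KatoDescentTamePotSupersingular.TameLowerHalfRankZero)
    (hR3 : ∀ (W : WeierstrassCurve ℚ) [W.IsElliptic] [W.IsGloballyMinimal] [NeZero (W.conductorNorm ℤ)],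
      ¬ W.HasCM → Rank1Residual.Addv W 3 → Summit.BirchSwinnertonDyer.Rank1Residual.Additive.SubTprime W 3 →
      ¬ W.HasIrreducibleModPGaloisRep 3 → W.analyticRank = 1 →
      ∀ (D : ModularParametrizationData W (W.conductorNorm ℤ)), ¬ (3 : ℤ) ∣ D.maninConstant →
        Rank1Residual.Typed.MissingUpperBoundAt W 3) :
    TameQuarticManinParity.TprimeHeegnerUpperOfManinUnit := fun hMi hMr ↦
  tprime_upper_three_rankOne_of_maninUnits_of_reduce_of_sigma_of_lowerRankZero_of_reducibleRows hGZ hKo hGZK hGZ73 hMN hnf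
    hFH hMi hMr hRed hSig (tprimeLowerRankZero_three_of_tameLowerHalfRankZero hKT) hR3

/-- **The `TameQuarticSolvent` twin (stmt-BirchSwinnertonDyer-23738's registered `crux_decl`
`TameQuarticSolvent.TprimeHeegnerUpperOfManinUnit`) BY NAME from the same displayed inputs.** CONDITIONAL; credits nothing.
[cite: MatarNekovar2019, Thm. 0.7 (p. 456)] [cite: Jetchev2008, Conj. 1.3 (p. 812)] [cite: Miller2011LMS, Def. 1.1] -/
theorem tprimeHeegnerUpperOfManinUnit_tqs_of_reduce_of_sigma_of_tameLowerHalfRankZero_of_reducibleRows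
    (hGZ : ∀ (N : ℕ) [NeZero N] (W : WeierstrassCurve ℚ) (K : Type) [Field K] [NumberField K],
      gross_zagier N W K)
    (hKo : ∀ (N : ℕ) [NeZero N] (W : WeierstrassCurve ℚ) (K : Type) [Field K] [NumberField K],
      kolyvagin N W K)
    (hGZK : rank_eq_analyticRank_of_analyticRank_le_one) (hGZ73 : GrossZagier1986_thm_I_7_3)
    (hMN : MatarNekovar2019.thm07_padicValNat_card_sha_primary_add_le_of_globalDivisibility_of_irreducible)
    (hnf : exists_isNewformOf) (hFH : friedbergHoffstein_exists_heegnerField_splitDivisors_twist_ne_zero)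
    (hRed : (∀ (W : WeierstrassCurve ℚ) [W.IsElliptic] [W.IsGloballyMinimal] [NeZero (W.conductorNorm ℤ)],
        ¬ W.HasCM → Rank1Residual.Addv W 3 → Summit.BirchSwinnertonDyer.Rank1Residual.Additive.SubTprime W 3 →
        W.analyticRank = 1 →
        ∀ (D : ModularParametrizationData W (W.conductorNorm ℤ)),
          (∀ z ∈ D.L.lattice, ∃ w ∈ periodLattice D.f, z = D.c * w) →
          (∀ (W' : WeierstrassCurve ℚ) [W'.IsElliptic] (D' : ModularParametrizationData W' (W.conductorNorm ℤ)),
              D'.f = D.f → D.modularDegree ≤ D'.modularDegree) →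
          Rank1Residual.Typed.MissingUpperBoundAt W 3) →
      ∀ (W : WeierstrassCurve ℚ) [W.IsElliptic] [W.IsGloballyMinimal],
        ¬ W.HasCM → Rank1Residual.Addv W 3 → Summit.BirchSwinnertonDyer.Rank1Residual.Additive.SubTprime W 3 →
        W.analyticRank = 1 → Rank1Residual.Typed.MissingUpperBoundAt W 3)
    (hSig : ∀ (W : WeierstrassCurve ℚ) [W.IsElliptic] [W.IsGloballyMinimal] [NeZero (W.conductorNorm ℤ)]
      (K : Type) [Field K] [NumberField K] (Dt : ModularParametrizationData W (W.conductorNorm ℤ))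
      (H : HeegnerDatum (W.conductorNorm ℤ) (NumberField.discr K)) (ι : K →+* ℂ) (P : (W.baseChange K).toAffine.Point),
      ¬ W.HasCM → Addv W 3 → SubTprime W 3 → W.HasIrreducibleModPGaloisRep 3 → W.analyticRank = 1 →
      ¬ (3 : ℤ) ∣ Dt.c → IsImaginaryQuadratic K → SatisfiesHeegnerHypothesis (W.conductorNorm ℤ) K →
      (W.quadraticTwist (NumberField.discr K : ℚ)).entireLFunction 1 ≠ 0 →
      WeierstrassCurve.Affine.Point.map ι.toRatAlgHom P = heegnerPointComplex Dt H → ¬ IsOfFinAddOrder P →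
      Odd (NumberField.discr K) →
      ∀ (s' : ℕ), s' ≤ padicValNat 3 W.tamagawaProduct →
      ∀ (n : ℕ) (d : KolyvaginHeegnerData Dt H.β ι n), Squarefree n →
      (∀ ℓ ∈ n.primeFactors, Zhang2014.IsKolyvaginPrime (W.conductorNorm ℤ) W K 3 ℓ ∧
        s' ≤ Zhang2014.kolyvaginIndex W 3 ℓ) → Koly.PDiv d 3 s')
    (hKT : KatoDescentTamePotSupersingular.TameLowerHalfRankZero)
    (hR3 : ∀ (W : WeierstrassCurve ℚ) [W.IsElliptic] [W.IsGloballyMinimal] [NeZero (W.conductorNorm ℤ)],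
      ¬ W.HasCM → Rank1Residual.Addv W 3 → Summit.BirchSwinnertonDyer.Rank1Residual.Additive.SubTprime W 3 →
      ¬ W.HasIrreducibleModPGaloisRep 3 → W.analyticRank = 1 →
      ∀ (D : ModularParametrizationData W (W.conductorNorm ℤ)), ¬ (3 : ℤ) ∣ D.maninConstant →
        Rank1Residual.Typed.MissingUpperBoundAt W 3) :
    TameQuarticSolvent.TprimeHeegnerUpperOfManinUnit := fun hMi hMr ↦
  tprime_upper_three_rankOne_of_maninUnits_of_reduce_of_sigma_of_lowerRankZero_of_reducibleRows hGZ hKo hGZK hGZ73 hMN hnf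
    hFH hMi hMr hRed hSig (tprimeLowerRankZero_three_of_tameLowerHalfRankZero hKT) hR3

/-! ## §2 The irreducible rows over a TWIST-UNIT field: no rank-zero lower half needed -/

/-- **Upper half at an additive `3` under IRREDUCIBILITY, from Σ AT ONE DATUM over the split twist-unit field — L₀-FREE.** For
`W` globally minimal, non-CM, additive at `3`, `E[3]` irreducible, `r_an(W) = 1`, a datum `Dt` at level `N_E`, and the split
twist-unit datum `SchneiderFree.Upper.TwistUnitFieldAt W 3` (`hTU`: a Heegner field `K` of odd `d_K` for `N_E` with
`L(W^{(d_K)},1) ≠ 0` and a member `W₂ ∼ W` with a minimal model of `W₂^{(d_K)}` of `3`-unit `#Ш_an`): IF the derived Heegner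
points of `Dt` over every such field are `3^{s′}`-divisible to depth `ord₃ ∏c_ℓ(W) + v₃(c(Dt))` (`hSig`), THEN
`Typed.MissingUpperBoundAt W 3`, given the printed facts and Cassels' invariance `hCassels` (the twist's lower half is
transported from the unit member: RHP's `missingLowerBoundAt_twistModel_of_unitMember`). No (t′) binder is needed.
[cite: GrossZagier1986, Thm. I.(6.3) and (7.3)] [cite: MatarNekovar2019, Thm. 0.7 (p. 456)] [cite: Jetchev2008, Conj. 1.3 (p. 812)]
[cite: MilneADT2006, Thm. I.7.3] [cite: Miller2011LMS, Def. 1.1] -/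
theorem upper_three_of_irreducible_of_sigmaAtDatum_of_twistUnit
    (hGZ : ∀ (N : ℕ) [NeZero N] (W : WeierstrassCurve ℚ) (K : Type) [Field K] [NumberField K],
      gross_zagier N W K)
    (hKo : ∀ (N : ℕ) [NeZero N] (W : WeierstrassCurve ℚ) (K : Type) [Field K] [NumberField K],
      kolyvagin N W K)
    (hGZK : rank_eq_analyticRank_of_analyticRank_le_one) (hmod : hasEntireLFunction_rat)
    (hGZ73 : GrossZagier1986_thm_I_7_3)
    (hMN : MatarNekovar2019.thm07_padicValNat_card_sha_primary_add_le_of_globalDivisibility_of_irreducible)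
    (hCassels : bsdRHS_eq_of_isIsogenous)
    (W : WeierstrassCurve ℚ) [W.IsElliptic] [W.IsGloballyMinimal] [NeZero (W.conductorNorm ℤ)]
    (hCM : ¬ W.HasCM) (hadd : Addv W 3) (hirr : W.HasIrreducibleModPGaloisRep 3) (hr : W.analyticRank = 1)
    (Dt : ModularParametrizationData W (W.conductorNorm ℤ)) (hTU : Upper.TwistUnitFieldAt W 3)
    (hSig : ∀ (K : Type) [Field K] [NumberField K]
      (H : HeegnerDatum (W.conductorNorm ℤ) (NumberField.discr K)) (ι : K →+* ℂ) (P : (W.baseChange K).toAffine.Point),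
      IsImaginaryQuadratic K → SatisfiesHeegnerHypothesis (W.conductorNorm ℤ) K →
      (W.quadraticTwist (NumberField.discr K : ℚ)).entireLFunction 1 ≠ 0 →
      WeierstrassCurve.Affine.Point.map ι.toRatAlgHom P = heegnerPointComplex Dt H → ¬ IsOfFinAddOrder P →
      Odd (NumberField.discr K) →
      ∀ (s' : ℕ), s' ≤ padicValNat 3 W.tamagawaProduct + padicValNat 3 Dt.c.natAbs →
      ∀ (n : ℕ) (d : KolyvaginHeegnerData Dt H.β ι n), Squarefree n →
      (∀ ℓ ∈ n.primeFactors, Zhang2014.IsKolyvaginPrime (W.conductorNorm ℤ) W K 3 ℓ ∧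
        s' ≤ Zhang2014.kolyvaginIndex W 3 ℓ) → Koly.PDiv d 3 s') :
    MissingUpperBoundAt W 3 := by
  -- the twist-unit field `K` of `W` and the unit member `W₂ ∼ W` with its twist model `W₂d`
  obtain ⟨K, _, _, W₂, W₂d, _, _, _, _, hK, hodd, hHN, hLt, hiso, ⟨C, hC⟩, qd, hqd, hv⟩ := hTU
  -- the Heegner datum and the `K`-rational Heegner point of `Dt`
  obtain ⟨β, hβ⟩ := exists_dvd_sq_sub_discr_holds (W.conductorNorm ℤ) K hK hHN
  obtain ⟨H, -⟩ := nonempty_heegnerDatum_holds (W.conductorNorm ℤ) K hK hβ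
  obtain ⟨ι⟩ : Nonempty (K →+* ℂ) := inferInstance
  obtain ⟨P, hP⟩ := heegnerPointComplex_mem_range_map_holds (W.conductorNorm ℤ) W K hK hHN Dt H ι
  -- a globally minimal model of the twist, of analytic rank `0`; its lower half from the unit member
  have hD0 : (NumberField.discr K : ℚ) ≠ 0 := by exact_mod_cast NumberField.discr_ne_zero K
  haveI hEt : (W.quadraticTwist (NumberField.discr K : ℚ)).IsElliptic := W.isElliptic_quadraticTwist hD0
  obtain ⟨Cd, hCd⟩ := hasGlobalMinimalModel_rat_holds (W.quadraticTwist (NumberField.discr K : ℚ))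
  haveI : (Cd • W.quadraticTwist (NumberField.discr K : ℚ)).IsGloballyMinimal := hCd
  have hrd : (Cd • W.quadraticTwist (NumberField.discr K : ℚ)).analyticRank = 0 := by
    rw [analyticRank_smul]
    exact analyticRank_eq_zero_of_entireLFunction_one_ne_zero _ hLt
  have hlow : MissingLowerBoundAt (Cd • W.quadraticTwist (NumberField.discr K : ℚ)) 3 :=
    missingLowerBoundAt_twistModel_of_unitMember hCassels hGZK hmod hiso hD0 hC Cd (by omega) hqd hv
  -- the Heegner point is non-torsion (Gross–Zagier)
  have hL0W : W.entireLFunction 1 = 0 := entireLFunction_one_eq_zero_of_analyticRank_eq_one hr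
  obtain ⟨-, hderiv⟩ := leadingLCoeff_eq_deriv_of_analyticRank_eq_one hr
  have hLK : LDerivEK W K ≠ 0 := by
    rw [lDerivEK_eq_deriv_mul W K hmod hL0W]; exact mul_ne_zero hderiv hLt
  have hnt : ¬ IsOfFinAddOrder P :=
    (lDerivEK_ne_zero_iff_not_isOfFinAddOrder W (W.conductorNorm ℤ) K (hGZ _ W K) hK hHN
      ⟨Dt, H, ι, hP⟩).mp hLK
  -- Σ at this datum ⟹ the socket ⟹ the upper half (companion file §2)
  exact upper_three_of_irreducible_of_globalDivisibility_of_twistLower hGZ hKo hGZK hmod hGZ73 hMN W hCM hadd hirr hr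
    K Dt H ι P (Cd • W.quadraticTwist (NumberField.discr K : ℚ)) hK hodd hHN hLt hP ⟨Cd, rfl⟩
    (fun s' hs' n d hn hℓ ↦ hSig K H ι P hK hHN hLt hP hnt hodd s' hs' n d hn hℓ) hlow

/-- **The TAMAGAWA-FREE rows under irreducibility from PRINT + the twist-unit datum ALONE** (no Σ, no rank-zero lower half, no
Friedberg–Hoffstein): `W` non-CM, additive at `3`, `E[3]` irreducible, `r_an(W) = 1`, `3 ∤ ∏_ℓ c_ℓ(W)`, a datum at level `N_E`
with `3 ∤ c`, and `TwistUnitFieldAt W 3`. [cite: MatarNekovar2019, Thm. 0.7 (p. 456) and §0.11 (p. 457)]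
[cite: GrossZagier1986, Thm. I.(6.3) and (7.3)] [cite: MilneADT2006, Thm. I.7.3] [cite: Miller2011LMS, Def. 1.1] -/
theorem upper_three_of_irreducible_tamFree_of_print_of_twistUnit
    (hGZ : ∀ (N : ℕ) [NeZero N] (W : WeierstrassCurve ℚ) (K : Type) [Field K] [NumberField K],
      gross_zagier N W K)
    (hKo : ∀ (N : ℕ) [NeZero N] (W : WeierstrassCurve ℚ) (K : Type) [Field K] [NumberField K],
      kolyvagin N W K)
    (hGZK : rank_eq_analyticRank_of_analyticRank_le_one) (hmod : hasEntireLFunction_rat)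
    (hGZ73 : GrossZagier1986_thm_I_7_3)
    (hMN : MatarNekovar2019.thm07_padicValNat_card_sha_primary_add_le_of_globalDivisibility_of_irreducible)
    (hCassels : bsdRHS_eq_of_isIsogenous)
    (W : WeierstrassCurve ℚ) [W.IsElliptic] [W.IsGloballyMinimal] [NeZero (W.conductorNorm ℤ)]
    (hCM : ¬ W.HasCM) (hadd : Addv W 3) (hirr : W.HasIrreducibleModPGaloisRep 3) (hr : W.analyticRank = 1)
    (htam : ¬ 3 ∣ W.tamagawaProduct)
    (Dt : ModularParametrizationData W (W.conductorNorm ℤ)) (hc : ¬ (3 : ℤ) ∣ Dt.c) (hTU : Upper.TwistUnitFieldAt W 3) :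
    MissingUpperBoundAt W 3 := by
  have ht0 : padicValNat 3 W.tamagawaProduct = 0 := padicValNat.eq_zero_of_not_dvd htam
  have hc0 : padicValNat 3 Dt.c.natAbs = 0 :=
    padicValNat.eq_zero_of_not_dvd fun h ↦ hc (Int.ofNat_dvd_left.mpr h)
  refine upper_three_of_irreducible_of_sigmaAtDatum_of_twistUnit hGZ hKo hGZK hmod hGZ73 hMN hCassels W hCM hadd hirr hr
    Dt hTU ?_
  intro K _ _ H ι P _ _ _ _ _ _ s' hs' n d _ _
  have hs0 : s' = 0 := by omega
  subst hs0
  exact koly_pDiv_zero d 3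

/-! ## §3 The crux BY NAME with the rank-zero lower half replaced by a class-wide twist-unit supply -/

/-- **`TameQuarticManinParity.TprimeHeegnerUpperOfManinUnit` BY NAME, L₀-FREE variant:** PUB + Cassels' invariance + the p-stub
(VERBATIM) + Σ on the irreducible optimal (t′) rank-one rows with `3 ∤ c(D)` + a CLASS-WIDE split twist-unit supply `hTU` on those
rows (for every such `W` some Heegner field `K` with `L(W^{(d_K)},1) ≠ 0` and a `3`-unit `#Ш_an` member of the twist's class — a
non-vanishing-mod-`3` statement of Vatsal / Kriz–Li type, NOT in print on these rows) + the reducible stub r₃ (VERBATIM). The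
rank-zero lower half (KT 19981) is then not needed. CONDITIONAL; credits nothing; the item stays open.
[cite: MatarNekovar2019, Thm. 0.7 (p. 456)] [cite: Jetchev2008, Conj. 1.3 (p. 812)] [cite: MilneADT2006, Thm. I.7.3]
[cite: Vatsal1999, Thm. 0.3] [cite: Miller2011LMS, Def. 1.1] -/
theorem tprimeHeegnerUpperOfManinUnit_of_reduce_of_sigma_of_twistUnitSupply_of_reducibleRows
    (hGZ : ∀ (N : ℕ) [NeZero N] (W : WeierstrassCurve ℚ) (K : Type) [Field K] [NumberField K],
      gross_zagier N W K)
    (hKo : ∀ (N : ℕ) [NeZero N] (W : WeierstrassCurve ℚ) (K : Type) [Field K] [NumberField K],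
      kolyvagin N W K)
    (hGZK : rank_eq_analyticRank_of_analyticRank_le_one) (hGZ73 : GrossZagier1986_thm_I_7_3)
    (hMN : MatarNekovar2019.thm07_padicValNat_card_sha_primary_add_le_of_globalDivisibility_of_irreducible)
    (hnf : exists_isNewformOf) (hCassels : bsdRHS_eq_of_isIsogenous)
    (hRed : (∀ (W : WeierstrassCurve ℚ) [W.IsElliptic] [W.IsGloballyMinimal] [NeZero (W.conductorNorm ℤ)],
        ¬ W.HasCM → Rank1Residual.Addv W 3 → Summit.BirchSwinnertonDyer.Rank1Residual.Additive.SubTprime W 3 →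
        W.analyticRank = 1 →
        ∀ (D : ModularParametrizationData W (W.conductorNorm ℤ)),
          (∀ z ∈ D.L.lattice, ∃ w ∈ periodLattice D.f, z = D.c * w) →
          (∀ (W' : WeierstrassCurve ℚ) [W'.IsElliptic] (D' : ModularParametrizationData W' (W.conductorNorm ℤ)),
              D'.f = D.f → D.modularDegree ≤ D'.modularDegree) →
          Rank1Residual.Typed.MissingUpperBoundAt W 3) →
      ∀ (W : WeierstrassCurve ℚ) [W.IsElliptic] [W.IsGloballyMinimal],
        ¬ W.HasCM → Rank1Residual.Addv W 3 → Summit.BirchSwinnertonDyer.Rank1Residual.Additive.SubTprime W 3 →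
        W.analyticRank = 1 → Rank1Residual.Typed.MissingUpperBoundAt W 3)
    (hSig : ∀ (W : WeierstrassCurve ℚ) [W.IsElliptic] [W.IsGloballyMinimal] [NeZero (W.conductorNorm ℤ)]
      (K : Type) [Field K] [NumberField K] (Dt : ModularParametrizationData W (W.conductorNorm ℤ))
      (H : HeegnerDatum (W.conductorNorm ℤ) (NumberField.discr K)) (ι : K →+* ℂ) (P : (W.baseChange K).toAffine.Point),
      ¬ W.HasCM → Addv W 3 → SubTprime W 3 → W.HasIrreducibleModPGaloisRep 3 → W.analyticRank = 1 →
      ¬ (3 : ℤ) ∣ Dt.c → IsImaginaryQuadratic K → SatisfiesHeegnerHypothesis (W.conductorNorm ℤ) K →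
      (W.quadraticTwist (NumberField.discr K : ℚ)).entireLFunction 1 ≠ 0 →
      WeierstrassCurve.Affine.Point.map ι.toRatAlgHom P = heegnerPointComplex Dt H → ¬ IsOfFinAddOrder P →
      Odd (NumberField.discr K) →
      ∀ (s' : ℕ), s' ≤ padicValNat 3 W.tamagawaProduct →
      ∀ (n : ℕ) (d : KolyvaginHeegnerData Dt H.β ι n), Squarefree n →
      (∀ ℓ ∈ n.primeFactors, Zhang2014.IsKolyvaginPrime (W.conductorNorm ℤ) W K 3 ℓ ∧
        s' ≤ Zhang2014.kolyvaginIndex W 3 ℓ) → Koly.PDiv d 3 s')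
    (hTU : ∀ (W : WeierstrassCurve ℚ) [W.IsElliptic] [W.IsGloballyMinimal],
      ¬ W.HasCM → Addv W 3 → SubTprime W 3 → W.HasIrreducibleModPGaloisRep 3 → W.analyticRank = 1 →
      Upper.TwistUnitFieldAt W 3)
    (hR3 : ∀ (W : WeierstrassCurve ℚ) [W.IsElliptic] [W.IsGloballyMinimal] [NeZero (W.conductorNorm ℤ)],
      ¬ W.HasCM → Rank1Residual.Addv W 3 → Summit.BirchSwinnertonDyer.Rank1Residual.Additive.SubTprime W 3 →
      ¬ W.HasIrreducibleModPGaloisRep 3 → W.analyticRank = 1 →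
      ∀ (D : ModularParametrizationData W (W.conductorNorm ℤ)), ¬ (3 : ℤ) ∣ D.maninConstant →
        Rank1Residual.Typed.MissingUpperBoundAt W 3) :
    TameQuarticManinParity.TprimeHeegnerUpperOfManinUnit := by
  have hmod : hasEntireLFunction_rat := hasEntireLFunction_rat_of_exists_isNewformOf hnf
  intro hMi hMr W _ _ hCM hadd hsub hr
  refine hRed ?_ W hCM hadd hsub hr
  intro W₀ _ _ _ hCM₀ hadd₀ hsub₀ hr₀ D₀ hlat hmin
  by_cases hirr : W₀.HasIrreducibleModPGaloisRep 3
  · have hc : ¬ (3 : ℤ) ∣ D₀.c := hMi W₀ hCM₀ hadd₀ hsub₀ hirr D₀ hlat hmin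
    refine upper_three_of_irreducible_of_sigmaAtDatum_of_twistUnit hGZ hKo hGZK hmod hGZ73 hMN hCassels W₀ hCM₀ hadd₀ hirr
      hr₀ D₀ (hTU W₀ hCM₀ hadd₀ hsub₀ hirr hr₀) ?_
    have hc0 : padicValNat 3 D₀.c.natAbs = 0 :=
      padicValNat.eq_zero_of_not_dvd fun h ↦ hc (Int.ofNat_dvd_left.mpr h)
    intro K _ _ H ι P hK hHN hLt hP hnt hodd s' hs' n d hn hℓ
    exact hSig W₀ K D₀ H ι P hCM₀ hadd₀ hsub₀ hirr hr₀ hc hK hHN hLt hP hnt hodd s' (by omega) n d hn hℓ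
  · exact hR3 W₀ hCM₀ hadd₀ hsub₀ hirr hr₀ D₀ (hMr W₀ hCM₀ hadd₀ hsub₀ hirr D₀ hlat hmin)

end Summit.BirchSwinnertonDyer.BirchSwinnertonDyer.Theorems.TprimeHeegnerUpperOfManinUnit

end
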